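import Literature.Barriers.CriticalPhenomena.RigorousRGSmallParameterMassScaleIncrements
import Literature.Barriers.CriticalPhenomena.RigorousRGSmallParameterPerturbativeBetaWMassless
import HarnessLib

/-!
# `RigorousRGSmallParameter` (Slade, Theorem 1.4.1): Lemma 5.2.3 — `β^:_j - β_j` is small below
# the mass scale (massive case)

Fourteenth file of the §10.3–§10.4 layer. G. Slade, *Critical exponents for long-range `O(n)`
models below the upper critical dimension*, Commun. Math. Phys. **358** (2018), §5.2:
"**Lemma 5.2.3.** Let `d = 1,2,3`; `α ∈ (d/2, 2∧d)`; `m̄² > 0`. There exists `z > 0` such that,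
uniformly in `m² ∈ [0,m̄²]` and `1 ≤ j ≤ j_m`, with a possibly `L`-dependent constant, (5.27)
`|β^:_j - β_j| ≤ O(L^{-zj} + L^{-z(j_m-j)})`." Proof (§10.4): "`|β^:_j - β_j| ≤ |η_{≥j} - η_{≥j+1}|
|w̄_j^{(1)}| + |η_{≥j+1}||w̄_j^{(1)} - w̄_{j+1}^{(1)}|` … It suffices to prove that there exists `z > 0`
such that, uniformly in `m² ∈ [0,m̄²]` and `j ≤ j_m`, `|η_{≥j} - η_{≥j+1}| ≲ L^{-zj} + L^{-z(j_m-j)}`,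
`|w̄_j^{(1)} - w̄_{j+1}^{(1)}| ≲ L^{-zj} + L^{-z(j_m-j)}`. We write `f_j = (1/(n+2))(η_{≥j} - η_{≥j+1})`
… (10.49) `f_j = L^{(d-α)j}Σ_{i≥j}(C_{i+1;0,0}(m²) - L^{d-α}C_{i+2;0,0})`. Let `q_i = c₀(0,m²L^{αi})`. By
Lemma 10.3.1, (10.50) `f_j = L^{(d-α)j}Σ_{i≥j}L^{-(d-α)(i+1)}(q_i - q_{i+1}) + O(L^{-j})`. By definition
of the mass scale `j_m`, `m²L^{αi} ≍ L^{α(i-j_m)}`. By Lemma 10.3.2, (10.51) `|q_i - q_{i+1}| ≲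
𝟙_{i≤j_m}L^{-zα(j_m-i)} + 𝟙_{i+1>j_m}L^{-2α(i-j_m)}`. Therefore … `|f_j| ≲ L^{-zα(j_m-j)} + L^{-j}`. …
`w̄^{(1)}_{j+1} - w̄^{(1)}_j = L^{-α(j+1)}Σ_{i=1}^{j+1}C_i^{(1)} - L^{-αj}Σ_{i=1}^jC_i^{(1)}`. Let `Q_i =
∫c₀(y,m²L^{αi})dy`. By Lemma 10.3.1, and by Riemann sum approximation, (10.52) `C_i^{(1)} =
L^{αi}(Q_i + O(L^{-i}))`. Then, for some `z' > 0`, (10.53) `|w̄^{(1)}_{j+1} - w̄^{(1)}_j| ≤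
|L^{-αj}Σ_{i=0}^jL^{αi}Q_{i+1} - L^{-αj}Σ_{i=1}^jL^{αi}Q_i| + L^{-z'j} ≤ L^{-αj}Σ_{i=1}^jL^{αi}|Q_{i+1} -
Q_i| + L^{-αj}Q_1 + L^{-z'j}`. … (10.54) … This gives the desired estimate and completes the proof."

Here for the explicit decomposition of the tree: `d ≥ 1`, `α ∈ (0,2)`, `α < d`, `L ≥ 2`,
`0 < m² ≤ 1` (`m̄² = 1`), `1 ≤ j` and `j+1 ≤ j_m = massScale L α m²`; the lattice term is
`(j+1)(L^j)^{-(α∧1)}` (the factor `j+1` absorbing the logarithm at `α = 1`) and the mass term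
`(L^{j_m-j})^{-z}`. Inputs: Lemma 10.3.1, (10.51) (`RigorousRGSmallParameterMassScaleIncrements`),
(10.52) (`FRD.sum_fracCov_asymp`, `RigorousRGSmallParameterPerturbativeBetaWMassless`), and the
uniform bounds of Lemma 5.2.1 (`PT.Slade2017_lem521_core`). In (10.50)–(10.51) both regimes of
(10.51) are merged into the single bound `|q_{i+1} - q_{i+2}| ≤ C_qL^{zα}(L^{j_m-j})^{-zα}L^{zα(i-j)}`
(`i ≥ j`), so that one geometric series in `L^{zα-(d-α)} < 1` (`zα ≤ (d-α)/2`) controls `f_j`; in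
(10.53)–(10.54) the telescoping `(L^α-1)Σ_{i=2}^jL^{αi}Q_i = L^{α(j+1)}Q_j - L^{2α}Q_1·𝟙 - Σ_{i=2}^j
L^{αi}(Q_i - Q_{i-1})` is used, with `|Q_i - Q_{i-1}| ≤ C_q(L^{j_m-j})^{-zα}L^{-zα(j-i+1)}` for
`3 ≤ i ≤ j`.

## What this file proves (everything; no definition, no named fact)

* **`FRD.abs_etaGe_sub_le_massive`** — `|η_{≥j}(m²) - η_{≥j+1}(m²)| ≤ C((L^j)⁻¹ + (L^{j_m-j})^{-zα})`
  (`0 < m² ≤ 1`, `1 ≤ j ≤ j_m`).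
* **`FRD.abs_wbarOne_sub_le_massive`** — `|w̄^{(1)}_{j+1}(m²) - w̄^{(1)}_j(m²)| ≤
  C((j+1)(L^j)^{-(α∧1)} + (L^{j_m-j})^{-zα})` (`1 ≤ j`, `j+1 ≤ j_m`).
* **`FRD.Slade2017_lem523`** — **Lemma 5.2.3, PROVED**: there are `z > 0`, `C` with
  `|β^:_j(m²) - β_j(m²)| ≤ C((j+1)(L^j)^{-(α∧1)} + (L^{j_m-j})^{-z})` for `0 < m² ≤ 1`, `1 ≤ j`,
  `j+1 ≤ j_m`.
-/

noncomputable section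

namespace Literature.Barriers.CriticalPhenomena

open _root_.MeasureTheory Set Filter
open scoped _root_.Topology Real

namespace LongRangePhi4

namespace FRD

open Literature.Probability.LatticeModels

variable {d : ℕ}

/-! ### `η_{≥j}(m²) - η_{≥j+1}(m²)` below the mass scale -/

set_option maxHeartbeats 1600000 in
/-- **`|η_{≥j}(m²) - η_{≥j+1}(m²)| ≤ C((L^j)⁻¹ + (L^{j_m-j})^{-zα})`** for `0 < m² ≤ 1`, `1 ≤ j ≤ j_m`
("(10.49)–(10.51): `f_j = L^{(d-α)j}Σ_{i≥j}L^{-(d-α)(i+1)}(q_i - q_{i+1}) + O(L^{-j})` … `|f_j| ≲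
L^{-zα(j_m-j)} + L^{-j}`"). The increments `|q_{i+1} - q_{i+2}|` are bounded uniformly by
`C_qL^{zα}(L^{j_m-j})^{-zα}L^{zα(i-j)}` (both regimes of (10.51) at once), so that a single geometric
series in `L^{zα}/L^{d-α} < 1` controls the sum. [cite: Slade2017, Lemma 5.2.3 (proof, §10.4, displays (10.49)–(10.51))] -/
theorem abs_etaGe_sub_le_massive (hd : 1 ≤ d) (n : ℕ) {α : ℝ} (hα0 : 0 < α) (hα2 : α < 2)
    (hαd : α < d) {L : ℝ} (hL : 2 ≤ L) :
    ∃ z : ℝ, 0 < z ∧ ∃ C : ℝ, 0 < C ∧ ∀ m2 : ℝ, 0 < m2 → m2 ≤ 1 → ∀ j : ℕ, 1 ≤ j → j ≤ massScale L α m2 →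
      |PT.etaGe d n L α m2 j - PT.etaGe d n L α m2 (j + 1)| ≤
        C * ((L ^ j)⁻¹ + (L ^ (massScale L α m2 - j)) ^ (-(z * α))) := by
  have hd' : (1 : ℝ) ≤ d := by exact_mod_cast hd
  have hL1 : (1 : ℝ) < L := by linarith
  have hL0 : (0 : ℝ) < L := by linarith
  obtain ⟨C₁, hC₁, h31⟩ := Slade2017_lem1031 hd hα0 hα2 hL
  obtain ⟨c', -, hsum⟩ := PT.summable_etaGe_and_abs_le hd n hα0 hα2 hαd (zero_le_one : (0 : ℝ) ≤ 1)
  obtain ⟨z, hz0, hzα, Cq, hCq, hq⟩ := abs_cZero_massArg_sub_le hd hα0 hα2 hαd hL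
  set ρ : ℝ := L ^ ((d : ℝ) - α) with hρ
  have hρ0 : 0 < ρ := Real.rpow_pos_of_pos hL0 _
  set θ : ℝ := L ^ (α - d - 1) with hθ
  have hθ0 : 0 < θ := Real.rpow_pos_of_pos hL0 _
  have hθ1 : θ < 1 := Real.rpow_lt_one_of_one_lt_of_neg hL1 (by linarith)
  -- the ratio of the mass-scale series: `r₁ = L^{zα}/ρ = L^{zα-(d-α)} < 1`
  set r₁ : ℝ := L ^ (z * α - ((d : ℝ) - α)) with hr₁
  have hr₁0 : 0 < r₁ := Real.rpow_pos_of_pos hL0 _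
  have hdα : 0 < (d : ℝ) - α := by linarith
  have hr₁1 : r₁ < 1 := Real.rpow_lt_one_of_one_lt_of_neg hL1 (by linarith)
  have h1θ : 0 < 1 - θ := by linarith
  have h1r : 0 < 1 - r₁ := by linarith
  refine ⟨z, hz0, (n + 2) * (2 * C₁) * θ / (1 - θ) + (n + 2) * Cq * L ^ (z * α) / (1 - r₁), by
    have := Real.rpow_pos_of_pos hL0 (z * α); positivity, fun m2 hm hm1 j hj hjJ => ?_⟩
  set J : ℕ := massScale L α m2 with hJ
  have hmul : ∀ a b : ℝ, L ^ a * L ^ b = L ^ (a + b) := fun a b => (Real.rpow_add hL0 a b).symm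
  have hLp : ∀ e : ℝ, 0 < L ^ e := fun e => Real.rpow_pos_of_pos hL0 e
  -- summability and closed form (as in the massless case)
  have hsm : ∀ j : ℕ, Summable fun k : ℕ => PT.etaPrime d n L α m2 (j + k) := by
    intro j
    have h := (hsum L hL m2 hm.le hm1 j).1
    have e : (fun k : ℕ => (ρ ^ k)⁻¹ * PT.etaCoeff d n L α m2 (j + k)) =
        fun k => ρ ^ j * PT.etaPrime d n L α m2 (j + k) := by
      funext k; unfold PT.etaCoeff; rw [← hρ, pow_add]; field_simp
    rw [e] at h
    refine (h.mul_left ((ρ ^ j)⁻¹)).congr fun k => ?_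
    field_simp
  have hge : ∀ j : ℕ, PT.etaGe d n L α m2 j = ρ ^ j * ∑' k : ℕ, PT.etaPrime d n L α m2 (j + k) := by
    intro j; unfold PT.etaGe; rw [← tsum_mul_left]
    refine tsum_congr fun k => ?_
    unfold PT.etaCoeff; rw [← hρ, pow_add]; field_simp
  -- the `q`-increments in unified geometric form: for `i ≥ j`,
  -- `|q_{i+1} - q_{i+2}| ≤ Cq L^{zα} (L^{J-j})^{-zα} L^{zα(i-j)}`
  set X : ℝ := (L ^ (J - j) : ℝ) ^ (-(z * α)) with hX
  have hX0 : 0 < X := Real.rpow_pos_of_pos (pow_pos hL0 _) _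
  have hXe : X = L ^ (-(z * α) * ((J : ℝ) - j)) := by
    rw [hX, ← Real.rpow_natCast, ← Real.rpow_mul hL0.le]; congr 1; push_cast [Nat.cast_sub hjJ]; ring
  have hDq : ∀ i : ℕ, j ≤ i →
      |cZero d L α 0 (m2 * (L ^ (i + 1)) ^ α) - cZero d L α 0 (m2 * (L ^ (i + 1 + 1)) ^ α)| ≤
        Cq * L ^ (z * α) * X * L ^ (z * α * ((i : ℝ) - j)) := by
    intro i hji
    have hji' : (j : ℝ) ≤ i := by exact_mod_cast hji
    obtain ⟨hlow, hhigh⟩ := hq m2 hm hm1 0 (i + 1)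
    rw [← hJ] at hlow hhigh
    have etarget : Cq * L ^ (z * α) * X * L ^ (z * α * ((i : ℝ) - j)) =
        Cq * L ^ (-(z * α) * ((J : ℝ) - i - 1)) := by
      rw [hXe, mul_assoc, mul_assoc, hmul, hmul]; congr 2; ring
    rw [etarget]
    rcases le_or_gt (i + 1) J with h1 | h1
    · refine (hlow h1).trans (le_of_eq ?_)
      rw [← Real.rpow_natCast, ← Real.rpow_mul hL0.le]; congr 2; push_cast [Nat.cast_sub h1]; ring
    · refine (hhigh h1.le).trans ?_
      have hb1 : (L ^ (i + 1 - J) : ℝ) ^ (-(2 * α)) ≤ 1 :=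
        Real.rpow_le_one_of_one_le_of_nonpos (one_le_pow₀ hL1.le) (by linarith)
      have hJi : (J : ℝ) ≤ i := by exact_mod_cast Nat.lt_succ_iff.1 h1
      have hb2 : (1 : ℝ) ≤ L ^ (-(z * α) * ((J : ℝ) - i - 1)) := by
        refine Real.one_le_rpow hL1.le ?_
        have : 0 ≤ z * α := by positivity
        nlinarith
      calc Cq * (L ^ (i + 1 - J) : ℝ) ^ (-(2 * α)) ≤ Cq * 1 := mul_le_mul_of_nonneg_left hb1 hCq.le
        _ ≤ Cq * L ^ (-(z * α) * ((J : ℝ) - i - 1)) := mul_le_mul_of_nonneg_left (by simpa using hb2) hCq.le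
  -- the increments `η'_i - ρ η'_{i+1}` for `i ≥ j`
  have hdiff : ∀ i : ℕ, j ≤ i →
      |PT.etaPrime d n L α m2 i - ρ * PT.etaPrime d n L α m2 (i + 1)| ≤
        (n + 2) * (2 * C₁ * θ ^ (i + 1)) + (n + 2) * ((ρ ^ (i + 1))⁻¹ * (Cq * L ^ (z * α) * X * L ^ (z * α * ((i : ℝ) - j)))) := by
    intro i hji
    unfold PT.etaPrime
    have h1 := h31 (i + 1) (by omega) m2 0
    have h2 := h31 (i + 1 + 1) (by omega) m2 0
    simp only [Pi.zero_apply, Int.cast_zero, zero_div] at h1 h2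
    set q₁ : ℝ := cZero d L α (fun _ : Fin d => (0 : ℝ)) (m2 * (L ^ (i + 1)) ^ α) with hq₁
    set q₂ : ℝ := cZero d L α (fun _ : Fin d => (0 : ℝ)) (m2 * (L ^ (i + 1 + 1)) ^ α) with hq₂
    set Λ₁ : ℝ := L ^ (i + 1) with hΛ₁
    set Λ₂ : ℝ := L ^ (i + 1 + 1) with hΛ₂
    have hΛ₁0 : 0 < Λ₁ := pow_pos hL0 _
    have hΛ₂0 : 0 < Λ₂ := pow_pos hL0 _
    have hρΛ : ρ * Λ₂ ^ (α - d) = Λ₁ ^ (α - d) := by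
      rw [hρ, hΛ₂, hΛ₁, ← Real.rpow_natCast L (i + 1 + 1), ← Real.rpow_natCast L (i + 1),
        ← Real.rpow_mul hL0.le, ← Real.rpow_mul hL0.le, ← Real.rpow_add hL0]
      congr 1; push_cast; ring
    have hΛρ : Λ₁ ^ (α - d) = (ρ ^ (i + 1))⁻¹ := by
      rw [hΛ₁, hρ, ← Real.rpow_natCast L (i + 1), ← Real.rpow_mul hL0.le, ← Real.rpow_mul_natCast hL0.le,
        ← Real.rpow_neg hL0.le]
      congr 1; push_cast; ring
    have hq : |q₁ - q₂| ≤ Cq * L ^ (z * α) * X * L ^ (z * α * ((i : ℝ) - j)) := by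
      have := hDq i hji
      simpa only [Pi.zero_def] using this
    have e : fracCov d L α m2 (i + 1) 0 - ρ * fracCov d L α m2 (i + 1 + 1) 0 =
        (fracCov d L α m2 (i + 1) 0 - Λ₁ ^ (α - d) * q₁) - ρ * (fracCov d L α m2 (i + 1 + 1) 0 - Λ₂ ^ (α - d) * q₂) +
          Λ₁ ^ (α - d) * (q₁ - q₂) := by
      rw [mul_sub (Λ₁ ^ (α - d)) q₁ q₂, ← hρΛ]; ring
    have hn2 : (0 : ℝ) < n + 2 := by positivity
    rw [show (n + 2 : ℝ) * fracCov d L α m2 (i + 1) 0 - ρ * ((n + 2) * fracCov d L α m2 (i + 1 + 1) 0) =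
      (n + 2) * (fracCov d L α m2 (i + 1) 0 - ρ * fracCov d L α m2 (i + 1 + 1) 0) by ring, abs_mul,
      abs_of_pos hn2, e, ← mul_add]
    refine mul_le_mul_of_nonneg_left ?_ hn2.le
    have hθ₁ : Λ₁ ^ (α - d) * Λ₁⁻¹ = θ ^ (i + 1) := by
      rw [hΛ₁, hθ, ← Real.rpow_neg_one, ← Real.rpow_natCast L (i + 1), ← Real.rpow_mul hL0.le,
        ← Real.rpow_mul hL0.le, ← Real.rpow_add hL0, ← Real.rpow_mul_natCast hL0.le]
      congr 1; push_cast; ring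
    have hθ₂ : ρ * (Λ₂ ^ (α - d) * Λ₂⁻¹) = θ ^ (i + 1) * L⁻¹ := by
      rw [← mul_assoc, hρΛ, hΛ₂, hΛ₁, hθ, ← Real.rpow_neg_one, ← Real.rpow_neg_one,
        ← Real.rpow_natCast L (i + 1), ← Real.rpow_natCast L (i + 1 + 1), ← Real.rpow_mul hL0.le,
        ← Real.rpow_mul hL0.le, ← Real.rpow_add hL0, ← Real.rpow_mul_natCast hL0.le, ← Real.rpow_add hL0]
      congr 1; push_cast; ring
    have hLinv : L⁻¹ ≤ 1 := inv_le_one_of_one_le₀ hL1.le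
    calc |(fracCov d L α m2 (i + 1) 0 - Λ₁ ^ (α - d) * q₁) - ρ * (fracCov d L α m2 (i + 1 + 1) 0 - Λ₂ ^ (α - d) * q₂) +
          Λ₁ ^ (α - d) * (q₁ - q₂)|
        ≤ |fracCov d L α m2 (i + 1) 0 - Λ₁ ^ (α - d) * q₁| + |ρ * (fracCov d L α m2 (i + 1 + 1) 0 - Λ₂ ^ (α - d) * q₂)| +
          |Λ₁ ^ (α - d) * (q₁ - q₂)| := (abs_add_le _ _).trans (add_le_add (abs_sub _ _) le_rfl)
      _ ≤ C₁ * Λ₁ ^ (α - d) * Λ₁⁻¹ + ρ * (C₁ * Λ₂ ^ (α - d) * Λ₂⁻¹) +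
          Λ₁ ^ (α - d) * (Cq * L ^ (z * α) * X * L ^ (z * α * ((i : ℝ) - j))) := by
          rw [abs_mul, abs_of_pos hρ0, abs_mul, abs_of_pos (Real.rpow_pos_of_pos hΛ₁0 _)]
          exact add_le_add (add_le_add h1 (mul_le_mul_of_nonneg_left h2 hρ0.le))
            (mul_le_mul_of_nonneg_left hq (Real.rpow_pos_of_pos hΛ₁0 _).le)
      _ = C₁ * θ ^ (i + 1) + C₁ * (θ ^ (i + 1) * L⁻¹) +
          (ρ ^ (i + 1))⁻¹ * (Cq * L ^ (z * α) * X * L ^ (z * α * ((i : ℝ) - j))) := by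
          rw [mul_assoc C₁, hθ₁, show ρ * (C₁ * Λ₂ ^ (α - d) * Λ₂⁻¹) = C₁ * (ρ * (Λ₂ ^ (α - d) * Λ₂⁻¹)) by ring,
            hθ₂, hΛρ]
      _ ≤ 2 * C₁ * θ ^ (i + 1) + (ρ ^ (i + 1))⁻¹ * (Cq * L ^ (z * α) * X * L ^ (z * α * ((i : ℝ) - j))) := by
          have : θ ^ (i + 1) * L⁻¹ ≤ θ ^ (i + 1) := mul_le_of_le_one_right (by positivity) hLinv
          nlinarith [pow_pos hθ0 (i + 1)]
  -- the difference of the two series and its majorant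
  have hsub : PT.etaGe d n L α m2 j - PT.etaGe d n L α m2 (j + 1) =
      ρ ^ j * ∑' k : ℕ, (PT.etaPrime d n L α m2 (j + k) - ρ * PT.etaPrime d n L α m2 (j + k + 1)) := by
    rw [hge j, hge (j + 1), pow_succ, mul_assoc, ← mul_sub, ← tsum_mul_left,
      ← (hsm j).tsum_sub ((hsm (j + 1)).mul_left ρ)]
    congr 1
    refine tsum_congr fun k => ?_
    rw [show j + 1 + k = j + k + 1 by omega]
  -- `r₁ = L^{zα} ρ⁻¹` and the `k`-th majorant
  have hr₁e : ∀ k : ℕ, (ρ ^ (j + k + 1))⁻¹ * L ^ (z * α * (((j + k : ℕ) : ℝ) - j)) = (ρ ^ (j + 1))⁻¹ * r₁ ^ k := by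
    intro k
    rw [hρ, hr₁, ← Real.rpow_mul_natCast hL0.le, ← Real.rpow_mul_natCast hL0.le, ← Real.rpow_mul_natCast hL0.le,
      ← Real.rpow_neg hL0.le, ← Real.rpow_neg hL0.le, hmul, hmul]
    congr 1; push_cast; ring
  set M₁ : ℝ := (n + 2) * (2 * C₁) with hM₁
  set M₂ : ℝ := (n + 2) * ((ρ ^ (j + 1))⁻¹ * (Cq * L ^ (z * α) * X)) with hM₂
  have hmaj : HasSum (fun k : ℕ => M₁ * θ ^ (j + k + 1) + M₂ * r₁ ^ k)
      (M₁ * (θ ^ (j + 1) / (1 - θ)) + M₂ * (1 - r₁)⁻¹) := by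
    refine HasSum.add ?_ ((hasSum_geometric_of_lt_one hr₁0.le hr₁1).mul_left M₂)
    have h := (hasSum_geometric_of_lt_one hθ0.le hθ1).mul_left (M₁ * θ ^ (j + 1))
    have e : (fun k : ℕ => M₁ * θ ^ (j + 1) * θ ^ k) = fun k => M₁ * θ ^ (j + k + 1) := by
      funext k; rw [show j + k + 1 = (j + 1) + k by omega, pow_add]; ring
    rw [e, show M₁ * θ ^ (j + 1) * (1 - θ)⁻¹ = M₁ * (θ ^ (j + 1) / (1 - θ)) by ring] at h
    exact h
  have htb : |∑' k : ℕ, (PT.etaPrime d n L α m2 (j + k) - ρ * PT.etaPrime d n L α m2 (j + k + 1))| ≤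
      M₁ * (θ ^ (j + 1) / (1 - θ)) + M₂ * (1 - r₁)⁻¹ := by
    have h := tsum_of_norm_bounded hmaj fun k => (by
      rw [Real.norm_eq_abs]
      refine (hdiff (j + k) (by omega)).trans (le_of_eq ?_)
      rw [show (ρ ^ (j + k + 1))⁻¹ * (Cq * L ^ (z * α) * X * L ^ (z * α * (((j + k : ℕ) : ℝ) - j))) =
        (Cq * L ^ (z * α) * X) * ((ρ ^ (j + k + 1))⁻¹ * L ^ (z * α * (((j + k : ℕ) : ℝ) - j))) by ring, hr₁e k, hM₁, hM₂]
      ring :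
        ‖PT.etaPrime d n L α m2 (j + k) - ρ * PT.etaPrime d n L α m2 (j + k + 1)‖ ≤
          M₁ * θ ^ (j + k + 1) + M₂ * r₁ ^ k)
    rwa [Real.norm_eq_abs] at h
  have hρθ : ρ ^ j * θ ^ (j + 1) = θ * (L ^ j)⁻¹ := by
    rw [hρ, hθ, ← Real.rpow_mul_natCast hL0.le, ← Real.rpow_mul_natCast hL0.le, ← Real.rpow_add hL0,
      ← Real.rpow_natCast L j, ← Real.rpow_neg hL0.le, ← Real.rpow_add hL0]
    congr 1; push_cast; ring
  have hρρ : ρ ^ j * (ρ ^ (j + 1))⁻¹ = ρ⁻¹ := by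
    rw [pow_succ, mul_inv, ← mul_assoc, mul_inv_cancel₀ (pow_pos hρ0 j).ne', one_mul]
  have hρ1 : ρ⁻¹ ≤ 1 := inv_le_one_of_one_le₀ (Real.one_le_rpow hL1.le hdα.le)
  rw [hsub, abs_mul, abs_of_pos (pow_pos hρ0 j)]
  calc ρ ^ j * |∑' k : ℕ, (PT.etaPrime d n L α m2 (j + k) - ρ * PT.etaPrime d n L α m2 (j + k + 1))|
      ≤ ρ ^ j * (M₁ * (θ ^ (j + 1) / (1 - θ)) + M₂ * (1 - r₁)⁻¹) := mul_le_mul_of_nonneg_left htb (pow_pos hρ0 j).le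
    _ = M₁ / (1 - θ) * (ρ ^ j * θ ^ (j + 1)) +
        (n + 2) * Cq * L ^ (z * α) / (1 - r₁) * (ρ ^ j * (ρ ^ (j + 1))⁻¹) * X := by
        rw [hM₂]; field_simp
    _ = (n + 2) * (2 * C₁) * θ / (1 - θ) * (L ^ j)⁻¹ + (n + 2) * Cq * L ^ (z * α) / (1 - r₁) * ρ⁻¹ * X := by
        rw [hρθ, hρρ, hM₁]; ring
    _ ≤ (n + 2) * (2 * C₁) * θ / (1 - θ) * (L ^ j)⁻¹ + (n + 2) * Cq * L ^ (z * α) / (1 - r₁) * 1 * X := by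
        have : 0 ≤ (n + 2) * Cq * L ^ (z * α) / (1 - r₁) := by have := hLp (z * α); positivity
        have h := mul_le_mul_of_nonneg_left hρ1 this
        nlinarith [mul_le_mul_of_nonneg_right h hX0.le]
    _ ≤ _ := by
        rw [mul_one, mul_add]
        refine add_le_add (mul_le_mul_of_nonneg_right ?_ (by positivity)) (mul_le_mul_of_nonneg_right ?_ hX0.le)
        · have : 0 ≤ (n + 2) * Cq * L ^ (z * α) / (1 - r₁) := by have := hLp (z * α); positivity
          linarith
        · have : 0 ≤ (n + 2) * (2 * C₁) * θ / (1 - θ) := by positivity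
          linarith


/-! ### `w̄^{(1)}_{j+1}(m²) - w̄^{(1)}_j(m²)` below the mass scale -/

set_option maxHeartbeats 1600000 in
/-- **`|w̄^{(1)}_{j+1}(m²) - w̄^{(1)}_j(m²)| ≤ C((j+1)(L^j)^{-(α∧1)} + (L^{j_m-j})^{-zα})`** for
`0 < m² ≤ 1`, `1 ≤ j`, `j+1 ≤ j_m` ("(10.52)–(10.54)": `C_i^{(1)} = L^{αi}(Q_i + O(L^{-i}))` and the
telescoping `(L^α-1)Σ_{i=2}^jL^{αi}Q_i = L^{α(j+1)}Q_j - L^{2α}Q_2 + Σ_{i=3}^jL^{αi}(Q_{i-1} - Q_i)`, with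
`|Q_{i-1} - Q_i| ≲ L^{-zα(j_m-i+1)}` below the mass scale).
[cite: Slade2017, Lemma 5.2.3 (proof, §10.4, displays (10.52)–(10.54))] -/
theorem abs_wbarOne_sub_le_massive (hd : 1 ≤ d) {α : ℝ} (hα0 : 0 < α) (hα2 : α < 2) (hαd : α < d)
    {L : ℝ} (hL : 2 ≤ L) :
    ∃ z : ℝ, 0 < z ∧ ∃ C : ℝ, 0 < C ∧ ∀ m2 : ℝ, 0 < m2 → m2 ≤ 1 → ∀ j : ℕ, 1 ≤ j → j + 1 ≤ massScale L α m2 →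
      |PT.wbarOne d L α m2 (j + 1) - PT.wbarOne d L α m2 j| ≤
        C * ((j + 1) * (L ^ j) ^ (-min α 1) + (L ^ (massScale L α m2 - j)) ^ (-(z * α))) := by
  have hd' : (1 : ℝ) ≤ d := by exact_mod_cast hd
  have hL1 : (1 : ℝ) ≤ L := by linarith
  have hL1' : (1 : ℝ) < L := by linarith
  have hL0 : (0 : ℝ) < L := by linarith
  obtain ⟨C₂, hC₂, hS⟩ := sum_fracCov_asymp hd hα0 hα2 hL
  obtain ⟨C₀, hC₀, hQb⟩ := abs_cZeroInt_le hd hα0 hα2 hL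
  obtain ⟨c, hc, hCb⟩ := PT.abs_fracCov_le_massFactor hd hα0 hα2 hαd (zero_le_one : (0 : ℝ) ≤ 1)
  obtain ⟨z, hz0, hzα, Cq, hCq, hq⟩ := abs_cZero_massArg_sub_le hd hα0 hα2 hαd hL
  set a : ℝ := L ^ α with ha
  have ha1 : 1 < a := Real.one_lt_rpow hL1' hα0
  have ha0 : 0 < a := by linarith
  -- ratio of the `Q`-increment series: `r₂ = L^{-(α + zα)} < 1`
  set r₂ : ℝ := L ^ (-(α + z * α)) with hr₂
  have hr₂0 : 0 < r₂ := Real.rpow_pos_of_pos hL0 _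
  have hzα0 : 0 < z * α := mul_pos hz0 hα0
  have hr₂1 : r₂ < 1 := Real.rpow_lt_one_of_one_lt_of_neg hL1' (by linarith)
  have h1r₂ : 0 < 1 - r₂ := by linarith
  set B₁ : ℝ := (L + 1) ^ d * c with hB₁
  refine ⟨z, hz0, 3 * C₀ * a + C₂ + B₁ + C₂ + 1 + (Cq + Cq / (1 - r₂)), by positivity, fun m2 hm hm1 j hj hjJ => ?_⟩
  set J : ℕ := massScale L α m2 with hJ
  set m : ℝ := min α 1 with hm'
  have hΛ1 : (1 : ℝ) ≤ L ^ j := one_le_pow₀ hL1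
  have hΛ0 : (0 : ℝ) < L ^ j := by positivity
  have hΛm0 : 0 < (L ^ j) ^ (-m) := Real.rpow_pos_of_pos hΛ0 _
  have hαm : (L ^ j) ^ (-α) ≤ (L ^ j) ^ (-m) := Real.rpow_le_rpow_of_exponent_le hΛ1 (by
    have := min_le_left α 1; linarith)
  have h1m : (L ^ j)⁻¹ ≤ (L ^ j) ^ (-m) := by
    rw [← Real.rpow_neg_one]; exact Real.rpow_le_rpow_of_exponent_le hΛ1 (by have := min_le_right α 1; linarith)
  set X : ℝ := (L ^ (J - j) : ℝ) ^ (-(z * α)) with hX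
  have hX0 : 0 < X := Real.rpow_pos_of_pos (pow_pos hL0 _) _
  have hmul : ∀ a b : ℝ, L ^ a * L ^ b = L ^ (a + b) := fun a b => (Real.rpow_add hL0 a b).symm
  have hXe : X = L ^ (-(z * α) * ((J : ℝ) - j)) := by
    rw [hX, ← Real.rpow_natCast, ← Real.rpow_mul hL0.le]; congr 1; push_cast [Nat.cast_sub (by omega : j ≤ J)]; ring
  -- notation
  set C1 : ℕ → ℝ := fun i => ∑ x ∈ PT.ball (L ^ i / 2), fracCov d L α m2 i x with hC1
  set Q : ℕ → ℝ := fun i => cZeroInt d L α (m2 * (L ^ i) ^ α) with hQ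
  set T : ℕ → ℝ := fun j => ∑ i ∈ Finset.Icc 1 j, C1 i with hT
  have hw : ∀ k : ℕ, k ≤ J → PT.wbarOne d L α m2 k = (a ^ k)⁻¹ * T k := by
    intro k hk
    unfold PT.wbarOne
    rw [PT.scaleMin_of_pos hm, ← hJ, min_eq_left hk, wOne_eq_sum hd hL1 α m2 k]
  have hai : ∀ i : ℕ, (L ^ i) ^ α = a ^ i := fun i => PT.pow_rpow_comm hL0.le i α
  have he : ∀ i : ℕ, 2 ≤ i → |C1 i - a ^ i * Q i| ≤ C₂ * a ^ i * (L ^ i)⁻¹ := by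
    intro i hi
    have h := hS i hi m2
    have e1 : (L ^ i) ^ α * cZeroInt d L α (m2 * (L ^ i) ^ α) = a ^ i * Q i := by rw [← hai i]
    have e2 : C₂ * (L ^ i) ^ α * (L ^ i)⁻¹ = C₂ * a ^ i * (L ^ i)⁻¹ := by rw [← hai i]
    rw [e1, e2] at h
    exact h
  -- `|C_1^{(1)}| ≤ B₁`
  have hC11 : |C1 1| ≤ B₁ := by
    have hM1 : PT.massFactor L α m2 1 ≤ 1 := PT.massFactor_le_one hL0 α hm.le 1
    have hM0 : 0 ≤ PT.massFactor L α m2 1 := (PT.massFactor_pos hL0 α hm.le 1).le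
    calc |C1 1| ≤ ∑ x ∈ PT.ball (L ^ 1 / 2), |fracCov d L α m2 1 x| := Finset.abs_sum_le_sum_abs _ _
      _ ≤ ∑ _x ∈ PT.ball (L ^ 1 / 2), c := Finset.sum_le_sum fun x _ => by
          have h := hCb L hL m2 hm.le hm1 1 le_rfl x
          simp only [Nat.sub_self, pow_zero, Real.one_rpow, mul_one] at h
          exact h.trans (mul_le_of_le_one_right hc.le hM1)
      _ = (PT.ball (d := d) (L ^ 1 / 2)).card * c := by rw [Finset.sum_const, nsmul_eq_mul]
      _ ≤ (L + 1) ^ d * c := by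
          refine mul_le_mul_of_nonneg_right ((PT.card_ball_le (by positivity)).trans (le_of_eq ?_)) hc.le
          rw [pow_one]; ring
  -- `|Q_i| ≤ C₀`, increments of `Q`
  have hQi : ∀ i, |Q i| ≤ C₀ := fun i => hQb _
  have hΔQ : ∀ i : ℕ, 3 ≤ i → i ≤ j → |Q (i - 1) - Q i| ≤ Cq * X * L ^ (-(z * α) * ((j : ℝ) - i + 1)) := by
    intro i hi3 hij
    have hiJ : i - 1 ≤ J := by omega
    have h := fun y => (hq m2 hm hm1 y (i - 1)).1 hiJ
    simp only [show i - 1 + 1 = i by omega] at h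
    have hb := abs_integral_cZero_sub_le hd hα0 hα2 hL h
    refine hb.trans (le_of_eq ?_)
    rw [← hJ, hXe, mul_assoc, hmul, ← Real.rpow_natCast, ← Real.rpow_mul hL0.le]
    congr 2; push_cast [Nat.cast_sub hiJ, Nat.cast_sub (by omega : 1 ≤ i)]; ring
  have hΔQj : |Q (j + 1) - Q j| ≤ Cq * X := by
    have h := fun y => (hq m2 hm hm1 y j).1 (by omega)
    have hb := abs_integral_cZero_sub_le hd hα0 hα2 hL h
    rw [abs_sub_comm]
    refine hb.trans (le_of_eq ?_)
    rw [← hJ]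
  -- decomposition of `T_j`
  have hIoc : Finset.Ioc 1 j = Finset.Icc 2 j := by
    ext i; simp only [Finset.mem_Ioc, Finset.mem_Icc]; omega
  have hTj : T j = C1 1 + ∑ i ∈ Finset.Icc 2 j, a ^ i * Q i + ∑ i ∈ Finset.Icc 2 j, (C1 i - a ^ i * Q i) := by
    simp only [hT]
    rw [Finset.Icc_eq_cons_Ioc hj, Finset.sum_cons, hIoc, add_assoc, ← Finset.sum_add_distrib]
    congr 1
    refine Finset.sum_congr rfl fun i _ => by ring
  -- telescoping: `(a-1)Σ_{i=2}^j a^iQ_i = a^{j+1}Q_j - a^2Q_2 + Σ_{i=3}^j a^i(Q_{i-1} - Q_i)` (for `j ≥ 2`;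
  -- for `j = 1` both sides vanish suitably) — proved by induction on `j`
  have htel : ∀ k : ℕ, 1 ≤ k → (a - 1) * ∑ i ∈ Finset.Icc 2 k, a ^ i * Q i =
      a ^ (k + 1) * Q k - a ^ 2 * Q 1 - ∑ i ∈ Finset.Icc 2 k, a ^ i * (Q i - Q (i - 1)) := by
    intro k hk
    induction k with
    | zero => omega
    | succ k ih =>
      rcases Nat.lt_or_ge k 1 with hk0 | hk1
      · have : k = 0 := by omega
        subst this
        simp
      · rw [Finset.sum_Icc_succ_top (by omega), Finset.sum_Icc_succ_top (by omega), mul_add, ih hk1,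
          show k + 1 - 1 = k by omega]
        ring
  -- the difference
  have hΔ : PT.wbarOne d L α m2 (j + 1) - PT.wbarOne d L α m2 j =
      (a ^ (j + 1))⁻¹ * C1 (j + 1) + ((a ^ (j + 1))⁻¹ - (a ^ j)⁻¹) * T j := by
    rw [hw (j + 1) hjJ, hw j (by omega)]
    simp only [hT]
    rw [Finset.sum_Icc_succ_top (by omega : 1 ≤ j + 1)]
    ring
  have haj0 : 0 < a ^ j := pow_pos ha0 j
  have haj10 : 0 < a ^ (j + 1) := pow_pos ha0 (j + 1)
  have hajm : (a ^ j)⁻¹ = (L ^ j) ^ (-α) := by rw [ha, ← PT.pow_rpow_comm hL0.le, Real.rpow_neg hΛ0.le]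
  -- main identity: with `S₂ = Σ_{i=2}^j a^i(Q_i - Q_{i-1})`,
  -- `a^{-(j+1)}a^{j+1}Q_{j+1} + (a^{-(j+1)} - a^{-j})Σ a^iQ_i = (Q_{j+1} - Q_j) + a^{1-j}Q_1 + a^{-(j+1)}S₂`
  have hmain : (a ^ (j + 1))⁻¹ * (a ^ (j + 1) * Q (j + 1)) + ((a ^ (j + 1))⁻¹ - (a ^ j)⁻¹) * ∑ i ∈ Finset.Icc 2 j, a ^ i * Q i =
      (Q (j + 1) - Q j) + a * (a ^ j)⁻¹ * Q 1 + (a ^ (j + 1))⁻¹ * ∑ i ∈ Finset.Icc 2 j, a ^ i * (Q i - Q (i - 1)) := by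
    have e1 : ((a ^ (j + 1))⁻¹ - (a ^ j)⁻¹) = -((a ^ (j + 1))⁻¹ * (a - 1)) := by
      have haj : a ^ j ≠ 0 := haj0.ne'
      field_simp
      ring
    rw [e1, neg_mul, mul_assoc, htel j hj]
    have haj : a ^ j ≠ 0 := haj0.ne'
    have haj1 : a ^ (j + 1) ≠ 0 := haj10.ne'
    field_simp
    ring
  rw [hΔ, hTj]
  have e2 : (a ^ (j + 1))⁻¹ * C1 (j + 1) + ((a ^ (j + 1))⁻¹ - (a ^ j)⁻¹) *
      (C1 1 + ∑ i ∈ Finset.Icc 2 j, a ^ i * Q i + ∑ i ∈ Finset.Icc 2 j, (C1 i - a ^ i * Q i)) =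
      ((Q (j + 1) - Q j) + a * (a ^ j)⁻¹ * Q 1 + (a ^ (j + 1))⁻¹ * ∑ i ∈ Finset.Icc 2 j, a ^ i * (Q i - Q (i - 1))) +
      (a ^ (j + 1))⁻¹ * (C1 (j + 1) - a ^ (j + 1) * Q (j + 1)) +
        ((a ^ (j + 1))⁻¹ - (a ^ j)⁻¹) * (C1 1 + ∑ i ∈ Finset.Icc 2 j, (C1 i - a ^ i * Q i)) := by
    rw [← hmain]; ring
  rw [e2]
  -- bounds: the lattice pieces exactly as in the massless case
  have hfac : |(a ^ (j + 1))⁻¹ - (a ^ j)⁻¹| ≤ (a ^ j)⁻¹ := by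
    have h1 : (a ^ (j + 1))⁻¹ ≤ (a ^ j)⁻¹ := inv_anti₀ haj0 (pow_le_pow_right₀ ha1.le (by omega))
    rw [abs_sub_comm, abs_of_nonneg (by linarith)]
    have : 0 ≤ (a ^ (j + 1))⁻¹ := by positivity
    linarith
  have hp2 : |(a ^ (j + 1))⁻¹ * (C1 (j + 1) - a ^ (j + 1) * Q (j + 1))| ≤ C₂ * (L ^ j) ^ (-m) := by
    rw [abs_mul, abs_of_pos (inv_pos.2 haj10)]
    calc (a ^ (j + 1))⁻¹ * |C1 (j + 1) - a ^ (j + 1) * Q (j + 1)| ≤ (a ^ (j + 1))⁻¹ * (C₂ * a ^ (j + 1) * (L ^ (j + 1))⁻¹) :=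
          mul_le_mul_of_nonneg_left (he (j + 1) (by omega)) (by positivity)
      _ = C₂ * (L ^ (j + 1))⁻¹ := by field_simp
      _ ≤ C₂ * (L ^ j) ^ (-m) := by
          refine mul_le_mul_of_nonneg_left (le_trans ?_ h1m) hC₂.le
          exact inv_anti₀ hΛ0 (pow_le_pow_right₀ hL1 (by omega))
  have hp3 : |((a ^ (j + 1))⁻¹ - (a ^ j)⁻¹) * (C1 1 + ∑ i ∈ Finset.Icc 2 j, (C1 i - a ^ i * Q i))| ≤
      (B₁ + C₂ * j) * (L ^ j) ^ (-m) := by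
    rw [abs_mul]
    have hsumb : (a ^ j)⁻¹ * |∑ i ∈ Finset.Icc 2 j, (C1 i - a ^ i * Q i)| ≤ C₂ * j * (L ^ j) ^ (-m) := by
      calc (a ^ j)⁻¹ * |∑ i ∈ Finset.Icc 2 j, (C1 i - a ^ i * Q i)|
          ≤ (a ^ j)⁻¹ * ∑ i ∈ Finset.Icc 2 j, |C1 i - a ^ i * Q i| :=
            mul_le_mul_of_nonneg_left (Finset.abs_sum_le_sum_abs _ _) (by positivity)
        _ ≤ (a ^ j)⁻¹ * ∑ i ∈ Finset.Icc 2 j, C₂ * a ^ i * (L ^ i)⁻¹ :=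
            mul_le_mul_of_nonneg_left (Finset.sum_le_sum fun i hi => he i (Finset.mem_Icc.1 hi).1) (by positivity)
        _ = ∑ i ∈ Finset.Icc 2 j, C₂ * ((L ^ j) ^ (-α) * (L ^ i) ^ (α - 1)) := by
            rw [Finset.mul_sum]
            refine Finset.sum_congr rfl fun i _ => ?_
            rw [hajm, ← hai i, Real.rpow_sub_one (pow_pos hL0 i).ne', div_eq_mul_inv]
            ring
        _ ≤ ∑ _i ∈ Finset.Icc 2 j, C₂ * (L ^ j) ^ (-m) := Finset.sum_le_sum fun i hi =>
            mul_le_mul_of_nonneg_left (rpow_err_le' hL1 α (Finset.mem_Icc.1 hi).2) hC₂.le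
        _ = (j - 1 : ℕ) * (C₂ * (L ^ j) ^ (-m)) := by rw [Finset.sum_const, Nat.card_Icc, nsmul_eq_mul]; congr 1
        _ ≤ j * (C₂ * (L ^ j) ^ (-m)) := by
            refine mul_le_mul_of_nonneg_right ?_ (by positivity)
            exact_mod_cast Nat.sub_le j 1
        _ = C₂ * j * (L ^ j) ^ (-m) := by ring
    calc |(a ^ (j + 1))⁻¹ - (a ^ j)⁻¹| * |C1 1 + ∑ i ∈ Finset.Icc 2 j, (C1 i - a ^ i * Q i)|
        ≤ (a ^ j)⁻¹ * (|C1 1| + |∑ i ∈ Finset.Icc 2 j, (C1 i - a ^ i * Q i)|) :=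
          mul_le_mul hfac (abs_add_le _ _) (abs_nonneg _) (by positivity)
      _ = (a ^ j)⁻¹ * |C1 1| + (a ^ j)⁻¹ * |∑ i ∈ Finset.Icc 2 j, (C1 i - a ^ i * Q i)| := by ring
      _ ≤ B₁ * (L ^ j) ^ (-m) + C₂ * j * (L ^ j) ^ (-m) := by
          refine add_le_add ?_ hsumb
          rw [hajm]
          calc (L ^ j) ^ (-α) * |C1 1| ≤ (L ^ j) ^ (-m) * B₁ := mul_le_mul hαm hC11 (abs_nonneg _) hΛm0.le
            _ = B₁ * (L ^ j) ^ (-m) := mul_comm _ _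
      _ = (B₁ + C₂ * j) * (L ^ j) ^ (-m) := by ring
  -- the mass pieces
  have hp1a : |a * (a ^ j)⁻¹ * Q 1| ≤ C₀ * a * (L ^ j) ^ (-m) := by
    rw [abs_mul, abs_mul, abs_of_pos ha0, abs_of_pos (inv_pos.2 haj0), hajm]
    calc a * (L ^ j) ^ (-α) * |Q 1| ≤ a * (L ^ j) ^ (-m) * C₀ := by
          refine mul_le_mul (mul_le_mul_of_nonneg_left hαm ha0.le) (hQi 1) (abs_nonneg _) (by positivity)
      _ = C₀ * a * (L ^ j) ^ (-m) := by ring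
  have hp1c : |(a ^ (j + 1))⁻¹ * ∑ i ∈ Finset.Icc 2 j, a ^ i * (Q i - Q (i - 1))| ≤
      (Cq * a * (L ^ j) ^ (-m)) * 0 + Cq / (1 - r₂) * X + 2 * C₀ * (L ^ j) ^ (-m) * a := by
    -- split off `i = 2` (bounded crudely by `2C₀ a^2 a^{-(j+1)} ≤ 2C₀ a (L^j)^{-α}`), the rest by `hΔQ`
    rw [abs_mul, abs_of_pos (inv_pos.2 haj10), mul_zero, zero_add]
    have hsplit : ∑ i ∈ Finset.Icc 2 j, a ^ i * (Q i - Q (i - 1)) =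
        (∑ i ∈ Finset.Icc 3 j, a ^ i * (Q i - Q (i - 1))) + (if 2 ≤ j then a ^ 2 * (Q 2 - Q 1) else 0) := by
      rcases Nat.lt_or_ge j 2 with hj2 | hj2
      · have h1 : Finset.Icc 2 j = ∅ := Finset.Icc_eq_empty_of_lt hj2
        have h2 : Finset.Icc 3 j = ∅ := Finset.Icc_eq_empty_of_lt (by omega)
        simp [h1, h2, show ¬ (2 ≤ j) from by omega]
      · rw [if_pos hj2, Finset.Icc_eq_cons_Ioc hj2, Finset.sum_cons, add_comm]
        congr 1
    have hrest : |∑ i ∈ Finset.Icc 3 j, a ^ i * (Q i - Q (i - 1))| ≤ a ^ (j + 1) * (Cq / (1 - r₂) * X) := by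
      -- `a^i |Q_i - Q_{i-1}| ≤ a^i Cq X L^{-zα(j-i+1)} = a^{j+1} Cq X r₂^{j+1-i}`
      have hterm : ∀ i ∈ Finset.Icc 3 j, |a ^ i * (Q i - Q (i - 1))| ≤ a ^ (j + 1) * (Cq * X) * r₂ ^ (j + 1 - i) := by
        intro i hi
        rw [Finset.mem_Icc] at hi
        rw [abs_mul, abs_of_pos (pow_pos ha0 i), abs_sub_comm]
        refine (mul_le_mul_of_nonneg_left (hΔQ i hi.1 hi.2) (pow_pos ha0 i).le).trans (le_of_eq ?_)
        have e : a ^ i * L ^ (-(z * α) * ((j : ℝ) - i + 1)) = a ^ (j + 1) * r₂ ^ (j + 1 - i) := by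
          rw [ha, hr₂, ← Real.rpow_mul_natCast hL0.le, ← Real.rpow_mul_natCast hL0.le,
            ← Real.rpow_mul_natCast hL0.le, hmul, hmul]
          congr 1; push_cast [Nat.cast_sub (by omega : i ≤ j + 1)]; ring
        calc a ^ i * (Cq * X * L ^ (-(z * α) * ((j : ℝ) - i + 1))) = Cq * X * (a ^ i * L ^ (-(z * α) * ((j : ℝ) - i + 1))) := by
              ring
          _ = _ := by rw [e]; ring
      calc |∑ i ∈ Finset.Icc 3 j, a ^ i * (Q i - Q (i - 1))| ≤ ∑ i ∈ Finset.Icc 3 j, |a ^ i * (Q i - Q (i - 1))| :=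
            Finset.abs_sum_le_sum_abs _ _
        _ ≤ ∑ i ∈ Finset.Icc 3 j, a ^ (j + 1) * (Cq * X) * r₂ ^ (j + 1 - i) := Finset.sum_le_sum hterm
        _ = a ^ (j + 1) * (Cq * X) * ∑ i ∈ Finset.Icc 3 j, r₂ ^ (j + 1 - i) := by rw [Finset.mul_sum]
        _ ≤ a ^ (j + 1) * (Cq * X) * (1 - r₂)⁻¹ := by
            refine mul_le_mul_of_nonneg_left ?_ (by positivity)
            -- reindex `l = j + 1 - i ∈ [1, j-2]` and compare with the full geometric series
            have hre : ∑ i ∈ Finset.Icc 3 j, r₂ ^ (j + 1 - i) = ∑ l ∈ Finset.Icc 1 (j - 2), r₂ ^ l := by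
              refine Finset.sum_nbij' (fun i => j + 1 - i) (fun l => j + 1 - l) (fun i hi => ?_) (fun l hl => ?_)
                (fun i hi => ?_) (fun l hl => ?_) (fun i hi => rfl)
              · rw [Finset.mem_Icc] at hi ⊢; omega
              · rw [Finset.mem_Icc] at hl ⊢; omega
              · rw [Finset.mem_Icc] at hi; omega
              · rw [Finset.mem_Icc] at hl; omega
            rw [hre]
            calc ∑ l ∈ Finset.Icc 1 (j - 2), r₂ ^ l ≤ ∑ l ∈ Finset.range (j - 2 + 1), r₂ ^ l := by
                  refine Finset.sum_le_sum_of_subset_of_nonneg (fun l hl => ?_) fun l _ _ => by positivity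
                  rw [Finset.mem_Icc] at hl; rw [Finset.mem_range]; omega
              _ ≤ ∑' l : ℕ, r₂ ^ l := (summable_geometric_of_lt_one hr₂0.le hr₂1).sum_le_tsum _ fun l _ => by positivity
              _ = (1 - r₂)⁻¹ := tsum_geometric_of_lt_one hr₂0.le hr₂1
        _ = a ^ (j + 1) * (Cq / (1 - r₂) * X) := by rw [div_eq_mul_inv]; ring
    have hfirst : |(if 2 ≤ j then a ^ 2 * (Q 2 - Q 1) else 0)| ≤ a ^ 2 * (2 * C₀) := by
      split_ifs
      · rw [abs_mul, abs_of_pos (pow_pos ha0 2)]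
        refine mul_le_mul_of_nonneg_left ((abs_sub _ _).trans ?_) (pow_pos ha0 2).le
        linarith [hQi 2, hQi 1]
      · simp only [abs_zero]; positivity
    have ha2 : (a ^ (j + 1))⁻¹ * (a ^ 2 * (2 * C₀)) = 2 * C₀ * (L ^ j) ^ (-α) * a := by
      rw [← hajm, pow_succ]; field_simp
    rw [hsplit]
    calc (a ^ (j + 1))⁻¹ * |(∑ i ∈ Finset.Icc 3 j, a ^ i * (Q i - Q (i - 1))) + (if 2 ≤ j then a ^ 2 * (Q 2 - Q 1) else 0)|
        ≤ (a ^ (j + 1))⁻¹ * (a ^ (j + 1) * (Cq / (1 - r₂) * X) + a ^ 2 * (2 * C₀)) :=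
          mul_le_mul_of_nonneg_left ((abs_add_le _ _).trans (add_le_add hrest hfirst)) (by positivity)
      _ = Cq / (1 - r₂) * X + 2 * C₀ * (L ^ j) ^ (-α) * a := by rw [mul_add, ha2]; field_simp
      _ ≤ Cq / (1 - r₂) * X + 2 * C₀ * (L ^ j) ^ (-m) * a := by
          have : 2 * C₀ * (L ^ j) ^ (-α) * a ≤ 2 * C₀ * (L ^ j) ^ (-m) * a :=
            mul_le_mul_of_nonneg_right (mul_le_mul_of_nonneg_left hαm (by positivity)) ha0.le
          linarith
  -- assemble
  have hj0 : (0 : ℝ) ≤ j := Nat.cast_nonneg j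
  have hB₁0 : 0 ≤ B₁ := by rw [hB₁]; positivity
  calc |((Q (j + 1) - Q j) + a * (a ^ j)⁻¹ * Q 1 + (a ^ (j + 1))⁻¹ * ∑ i ∈ Finset.Icc 2 j, a ^ i * (Q i - Q (i - 1))) +
        (a ^ (j + 1))⁻¹ * (C1 (j + 1) - a ^ (j + 1) * Q (j + 1)) +
        ((a ^ (j + 1))⁻¹ - (a ^ j)⁻¹) * (C1 1 + ∑ i ∈ Finset.Icc 2 j, (C1 i - a ^ i * Q i))|
      ≤ (Cq * X + C₀ * a * (L ^ j) ^ (-m) + (Cq / (1 - r₂) * X + 2 * C₀ * (L ^ j) ^ (-m) * a)) +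
          C₂ * (L ^ j) ^ (-m) + (B₁ + C₂ * j) * (L ^ j) ^ (-m) := by
        refine (abs_add_le _ _).trans (add_le_add ((abs_add_le _ _).trans (add_le_add ?_ hp2)) hp3)
        refine (abs_add_le _ _).trans (add_le_add ((abs_add_le _ _).trans (add_le_add hΔQj hp1a)) ?_)
        have h := hp1c
        rw [mul_zero, zero_add] at h
        exact h
    _ = (C₀ * a + 2 * C₀ * a + C₂ + B₁ + C₂ * j) * (L ^ j) ^ (-m) + (Cq + Cq / (1 - r₂)) * X := by ring
    _ ≤ (3 * C₀ * a + C₂ + B₁ + C₂ + 1 + (Cq + Cq / (1 - r₂))) * ((j + 1) * (L ^ j) ^ (-m)) +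
          (3 * C₀ * a + C₂ + B₁ + C₂ + 1 + (Cq + Cq / (1 - r₂))) * X := by
        have hK0 : 0 ≤ Cq + Cq / (1 - r₂) := by positivity
        have h6 : 0 ≤ C₀ * a := by positivity
        refine add_le_add ?_ (mul_le_mul_of_nonneg_right (by nlinarith) hX0.le)
        rw [← mul_assoc]
        refine mul_le_mul_of_nonneg_right ?_ hΛm0.le
        nlinarith [mul_nonneg h6 hj0, mul_nonneg hB₁0 hj0, mul_nonneg hC₂.le hj0, mul_nonneg hK0 hj0]
    _ = _ := by ring

/-! ### Lemma 5.2.3 -/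

/-- **Slade, Lemma 5.2.3, PROVED for the explicit decomposition** (below the mass scale): "Let …
`m̄² > 0`. There exists `z > 0` such that, uniformly in `m² ∈ [0,m̄²]` and `1 ≤ j ≤ j_m`, with a
possibly `L`-dependent constant, (5.27) `|β^:_j - β_j| ≤ O(L^{-zj} + L^{-z(j_m-j)})`." Here for
`d ≥ 1`, `α ∈ (0,2)`, `α < d`, `L ≥ 2`, `0 < m² ≤ 1` and `1 ≤ j ≤ j_m - 1` (`j_m = massScale L α m²`),
with the lattice rate `(j+1)(L^j)^{-(α∧1)}` and the mass rate `(L^{j_m-j})^{-zα}`; the massless case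
(`j_m = ∞`) is `FRD.Slade2017_lem523_massless`. Proof as printed: `|β^:_j - β_j| ≤
4(|η_{≥j} - η_{≥j+1}||w̄_j^{(1)}| + |η_{≥j+1}||w̄_j^{(1)} - w̄_{j+1}^{(1)}|)` and the two increment bounds.
[cite: Slade2017, Lemma 5.2.3 (display (5.27)) and its proof, §10.4 (displays (10.49)–(10.54))] -/
theorem Slade2017_lem523 (hd : 1 ≤ d) (n : ℕ) {α : ℝ} (hα0 : 0 < α) (hα2 : α < 2) (hαd : α < d)
    {L : ℝ} (hL : 2 ≤ L) :
    ∃ z : ℝ, 0 < z ∧ ∃ C : ℝ, 0 < C ∧ ∀ m2 : ℝ, 0 < m2 → m2 ≤ 1 → ∀ j : ℕ, 1 ≤ j → j + 1 ≤ massScale L α m2 →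
      |PT.betaWCoeff d n L α m2 j - PT.betaCoeff d n L α m2 j| ≤
        C * ((j + 1) * (L ^ j) ^ (-min α 1) + (L ^ (massScale L α m2 - j)) ^ (-z)) := by
  have hL1 : (1 : ℝ) ≤ L := by linarith
  have hL0 : (0 : ℝ) < L := by linarith
  obtain ⟨z₁, hz₁, Cη, hCη, hη⟩ := abs_etaGe_sub_le_massive hd n hα0 hα2 hαd hL
  obtain ⟨z₂, hz₂, Cw, hCw, hw⟩ := abs_wbarOne_sub_le_massive hd hα0 hα2 hαd hL
  obtain ⟨c, hc, hcore⟩ := PT.Slade2017_lem521_core hd n hα0 hα2 hαd (zero_le_one : (0 : ℝ) ≤ 1) hL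
  set z : ℝ := min (z₁ * α) (z₂ * α) with hz
  have hz0 : 0 < z := lt_min (mul_pos hz₁ hα0) (mul_pos hz₂ hα0)
  refine ⟨z, hz0, 4 * (Cη * c + c * Cw), by positivity, fun m2 hm hm1 j hj hjJ => ?_⟩
  set J : ℕ := massScale L α m2 with hJ
  have hΛ1 : (1 : ℝ) ≤ L ^ j := one_le_pow₀ hL1
  have hΛ0 : (0 : ℝ) < L ^ j := by positivity
  have hΛm0 : 0 < (L ^ j) ^ (-min α 1) := Real.rpow_pos_of_pos hΛ0 _
  have h1m : (L ^ j)⁻¹ ≤ (L ^ j) ^ (-min α 1) := by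
    rw [← Real.rpow_neg_one]; exact Real.rpow_le_rpow_of_exponent_le hΛ1 (by have := min_le_right α 1; linarith)
  have hY1 : (1 : ℝ) ≤ L ^ (J - j) := one_le_pow₀ hL1
  set Y : ℝ := (L ^ (J - j) : ℝ) ^ (-z) with hY
  have hY0 : 0 < Y := Real.rpow_pos_of_pos (by positivity) _
  have hY₁ : (L ^ (J - j) : ℝ) ^ (-(z₁ * α)) ≤ Y :=
    Real.rpow_le_rpow_of_exponent_le hY1 (by have := min_le_left (z₁ * α) (z₂ * α); linarith)
  have hY₂ : (L ^ (J - j) : ℝ) ^ (-(z₂ * α)) ≤ Y :=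
    Real.rpow_le_rpow_of_exponent_le hY1 (by have := min_le_right (z₁ * α) (z₂ * α); linarith)
  obtain ⟨-, -, -, -, hwb⟩ := hcore m2 hm.le hm1 j
  obtain ⟨-, hge2, -, -, -⟩ := hcore m2 hm.le hm1 (j + 1)
  have hM : PT.massFactor L α m2 (j + 1) ≤ 1 := PT.massFactor_le_one hL0 α hm.le (j + 1)
  have hge2' : |PT.etaGe d n L α m2 (j + 1)| ≤ c := hge2.trans (mul_le_of_le_one_right hc.le hM)
  have hdη := hη m2 hm hm1 j hj (by omega)
  have hdw := hw m2 hm hm1 j hj hjJ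
  rw [← hJ] at hdη hdw
  unfold PT.betaWCoeff betaW
  rw [show PT.betaCoeff d n L α m2 j + 4 * (PT.etaGe d n L α m2 j * PT.wbarOne d L α m2 j -
      PT.etaGe d n L α m2 (j + 1) * PT.wbarOne d L α m2 (j + 1)) - PT.betaCoeff d n L α m2 j =
      4 * ((PT.etaGe d n L α m2 j - PT.etaGe d n L α m2 (j + 1)) * PT.wbarOne d L α m2 j -
        PT.etaGe d n L α m2 (j + 1) * (PT.wbarOne d L α m2 (j + 1) - PT.wbarOne d L α m2 j)) by ring,
    abs_mul, abs_of_pos (by norm_num : (0 : ℝ) < 4)]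
  have hj0 : (1 : ℝ) ≤ j + 1 := by linarith [Nat.cast_nonneg (α := ℝ) j]
  set E : ℝ := (j + 1) * (L ^ j) ^ (-min α 1) + Y with hE
  have hE0 : 0 < E := by positivity
  have hb1 : (L ^ j)⁻¹ + (L ^ (J - j) : ℝ) ^ (-(z₁ * α)) ≤ E := by
    refine add_le_add (h1m.trans ?_) hY₁
    exact le_mul_of_one_le_left hΛm0.le hj0
  have hb2 : (j + 1) * (L ^ j) ^ (-min α 1) + (L ^ (J - j) : ℝ) ^ (-(z₂ * α)) ≤ E := add_le_add le_rfl hY₂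
  calc 4 * |(PT.etaGe d n L α m2 j - PT.etaGe d n L α m2 (j + 1)) * PT.wbarOne d L α m2 j -
        PT.etaGe d n L α m2 (j + 1) * (PT.wbarOne d L α m2 (j + 1) - PT.wbarOne d L α m2 j)|
      ≤ 4 * (|PT.etaGe d n L α m2 j - PT.etaGe d n L α m2 (j + 1)| * |PT.wbarOne d L α m2 j| +
          |PT.etaGe d n L α m2 (j + 1)| * |PT.wbarOne d L α m2 (j + 1) - PT.wbarOne d L α m2 j|) := by
        refine mul_le_mul_of_nonneg_left ((abs_sub _ _).trans ?_) (by norm_num)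
        rw [abs_mul, abs_mul]
    _ ≤ 4 * (Cη * ((L ^ j)⁻¹ + (L ^ (J - j) : ℝ) ^ (-(z₁ * α))) * c +
          c * (Cw * ((j + 1) * (L ^ j) ^ (-min α 1) + (L ^ (J - j) : ℝ) ^ (-(z₂ * α))))) := by
        gcongr
    _ ≤ 4 * (Cη * E * c + c * (Cw * E)) := by
        gcongr
    _ = 4 * (Cη * c + c * Cw) * E := by ring

end FRD

end LongRangePhi4

end Literature.Barriers.CriticalPhenomena
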